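import Literature.IUT.LogVolume.RArithmeticDivisors
import Literature.NumberTheory.DiophantineGeometry.GenEllProjLine
import HarnessLib

/-!
# [GenEll] Definition 1.5 (iii)(iv): the effective arithmetic divisors `δ_x` (different) and `(D_x)_red`
# (reduced conductor) of a point, as arithmetic divisors — nonzero ideals of `O_F` as effective divisors
# with `deg_F = log N(−)`

S. Mochizuki, *Arithmetic elliptic curves in general position*, Math. J. Okayama Univ. **52** (2010),
Definition 1.5, journal pp. 8–9 — the Definition starts on p. 8, items (iii), (iv) are on p. 9 — (read on
the page, corpus `paper:doi-10-18926-mjou-33503`; the tree's `GenEllProjLine` cites the kurims manuscript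
pagination, where Def. 1.5 is on p. 8): "(iii) … the
different ideal of `F` determines an effective arithmetic divisor `δ_x` on `F` [supported at the finite
primes]; we set `log-diff_X(x) := deg_F(δ_x) ∈ ℝ`. (iv) … an effective divisor `D_x` on `Spec(O_F)` … the
reduced divisor `(D_x)_red`, an effective arithmetic divisor on `F`; we set `log-cond_D(x) := deg_F((D_x)_red)
∈ ℝ`" (`deg_F` normalised, §1 p. 5).

The tree's `GenEllProjLine` (namespace `…DiophantineGeometry.GenEll.NFPoint`) types these two functions
DIRECTLY as numbers: `logDiff P = (1/[F:ℚ])·log N(𝔡_F)` and `logCond P = (1/[F:ℚ])·log ∏_{v ∈ supp D_x}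
N(v)`, saying in prose that these are `deg_F(δ_x)`, `deg_F((D_x)_red)`. This file supplies the divisors
themselves inside `ADiv_ℝ(F)` ([IUTchIV] Def. 1.9, `RArithmeticDivisors`) and PROVES the two prose
identities:

* `ADivisor.ofIdeal I = Σ_v ord_v(I)·v` for a nonzero ideal `I ⊆ O_F` (`ord_v(I)` = Mathlib's
  `multiplicity v.asIdeal I`), effective, additive in `I` (`ofIdeal_mul`), with
  **`degF_ofIdeal : deg_F(Σ_v ord_v(I)·v) = log N(I)`** (unique factorisation + multiplicativity of
  `Ideal.absNorm`) (for `x ∈ O_F ∖ 0`, `ofIdeal (x)` is the finite part of the principal divisor `ADiv(x)`: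
  `ArithmeticDivisorsFrdBridge.ofIdeal_span_singleton_apply_inr`);
* `differentDivisor F = δ` (`ofIdeal` of Mathlib's `differentIdeal ℤ (𝓞 F)`) and
  **`logDiff_eq_ndeg_differentDivisor : logDiff P = deg(δ_{P})`**;
* `ADivisor.reduced S = Σ_{v ∈ S} v` and **`logCond_eq_ndeg_reduced : logCond P = deg((D_x)_red)`** for
  `x ∈ U_P(F)` (the support `supp D_x` = `condSupport P`, finite by `condSupport_finite`).
Classical algebraic number theory; no statement of the disputed corpus is involved.
[cite: MochizukiGenEll2010, Def. 1.5 (iii)(iv) p.9]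
-/

noncomputable section

namespace Literature.IUT.LogVolume

open NumberField IsDedekindDomain Finset
open Literature.NumberTheory.DiophantineGeometry.GenEll

variable (F : Type*) [Field F] [NumberField F]

/-- Only finitely many primes divide a nonzero ideal: `{v : ord_v(I) ≠ 0}` is finite.
[cite: MochizukiGenEll2010, Def. 1.5 (iii) p.9] -/
theorem finite_setOf_multiplicity_ne_zero {I : Ideal (𝓞 F)} (hI : I ≠ ⊥) :
    {v : HeightOneSpectrum (𝓞 F) | multiplicity v.asIdeal I ≠ 0}.Finite :=
  (Ideal.finite_factors hI).subset fun _ hv =>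
    dvd_of_multiplicity_pos (Nat.pos_of_ne_zero hv)

namespace ADivisor

variable {F}

/-- **The effective arithmetic divisor of a nonzero ideal** `I ⊆ O_F`: `Σ_{v ∈ 𝕍(F)^non} ord_v(I)·v`
(no archimedean part; junk `0` for `I = 0`). [cite: MochizukiGenEll2010, Def. 1.5 (iii) p.9] -/
def ofIdeal (I : Ideal (𝓞 F)) : ADivisor F :=
  if hI : I = ⊥ then 0 else
    (0 : InfinitePlace F →₀ ℝ).sumElim
      (Finsupp.ofSupportFinite (fun v => (multiplicity v.asIdeal I : ℝ))
        (by simpa [Function.support] using finite_setOf_multiplicity_ne_zero F hI))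

/-- No archimedean component. [cite: MochizukiGenEll2010, Def. 1.5 (iii) p.9] -/
@[simp] theorem ofIdeal_apply_inl (I : Ideal (𝓞 F)) (w : InfinitePlace F) : ofIdeal I (Sum.inl w) = 0 := by
  unfold ofIdeal
  split_ifs <;> rfl

/-- Finite coefficients: `ord_v(I)`. [cite: MochizukiGenEll2010, Def. 1.5 (iii) p.9] -/
@[simp] theorem ofIdeal_apply_inr {I : Ideal (𝓞 F)} (hI : I ≠ ⊥) (v : HeightOneSpectrum (𝓞 F)) :
    ofIdeal I (Sum.inr v) = (multiplicity v.asIdeal I : ℝ) := by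
  unfold ofIdeal
  rw [dif_neg hI]
  rfl

/-- `ofIdeal 0 = 0` (junk). [cite: MochizukiGenEll2010, Def. 1.5 (iii) p.9] -/
@[simp] theorem ofIdeal_bot : ofIdeal (⊥ : Ideal (𝓞 F)) = 0 := by
  unfold ofIdeal
  rw [dif_pos rfl]

/-- The divisor of an ideal is effective. [cite: MochizukiGenEll2010, Def. 1.5 (iii) p.9] -/
theorem ofIdeal_isEffective (I : Ideal (𝓞 F)) : (ofIdeal I).IsEffective := by
  by_cases hI : I = ⊥
  · subst hI; intro _; simp
  rintro (w | v)
  · simp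
  · rw [ofIdeal_apply_inr hI]; exact Nat.cast_nonneg _

/-- `ofIdeal 1 = 0` (the unit ideal). [cite: MochizukiGenEll2010, Def. 1.5 (iii) p.9] -/
@[simp] theorem ofIdeal_top : ofIdeal (⊤ : Ideal (𝓞 F)) = 0 := by
  ext (w | v)
  · simp
  · rw [ofIdeal_apply_inr top_ne_bot, Finsupp.coe_zero, Pi.zero_apply, ← Ideal.one_eq_top,
      multiplicity_of_one_right v.prime.not_unit, Nat.cast_zero]

/-- Additivity: `ord_v(IJ) = ord_v(I) + ord_v(J)`. [cite: MochizukiGenEll2010, Def. 1.5 (iii) p.9] -/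
theorem ofIdeal_mul {I J : Ideal (𝓞 F)} (hI : I ≠ ⊥) (hJ : J ≠ ⊥) :
    ofIdeal (I * J) = ofIdeal I + ofIdeal J := by
  have hIJ : I * J ≠ ⊥ := mul_ne_zero hI hJ
  ext (w | v)
  · simp
  · rw [Finsupp.add_apply, ofIdeal_apply_inr hIJ, ofIdeal_apply_inr hI, ofIdeal_apply_inr hJ,
      multiplicity_mul v.prime (FiniteMultiplicity.of_prime_left v.prime hIJ), Nat.cast_add]

end ADivisor

/-! ### `deg_F(Σ_v ord_v(I)·v) = log N(I)` -/

/-- **`deg_F` of the divisor of a nonzero ideal is the log of its norm**: `Σ_v ord_v(I)·log(q_v) = log N(I)`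
(unique factorisation `I = ∏ v^{ord_v(I)}` and multiplicativity of `N`). [cite: MochizukiGenEll2010, Def. 1.5 (iii) p.9] -/
theorem degF_ofIdeal {I : Ideal (𝓞 F)} (hI : I ≠ ⊥) :
    degF F (ADivisor.ofIdeal I) = Real.log (Ideal.absNorm I) := by
  set T : Finset (HeightOneSpectrum (𝓞 F)) := (finite_setOf_multiplicity_ne_zero F hI).toFinset with hT
  -- `I = ∏_{v ∈ T} v^{ord_v(I)}`
  have hfact : ∏ v ∈ T, v.asIdeal ^ multiplicity v.asIdeal I = I := by
    rw [← finprod_eq_prod_of_mulSupport_subset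
      (fun v : HeightOneSpectrum (𝓞 F) => v.asIdeal ^ multiplicity v.asIdeal I)]
    · exact Ideal.finprod_heightOneSpectrum_pow_multiplicity hI
    · intro v hv
      rw [Function.mem_mulSupport] at hv
      rw [hT, Set.Finite.coe_toFinset]
      exact fun h => hv (by rw [h, pow_zero])
  have hnorm : (Ideal.absNorm I : ℝ) = ∏ v ∈ T, (Ideal.absNorm v.asIdeal : ℝ) ^ multiplicity v.asIdeal I := by
    conv_lhs => rw [← hfact]
    rw [map_prod]
    simp only [map_pow, Nat.cast_prod, Nat.cast_pow]
  -- the degree as a sum over `T`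
  have hdeg : degF F (ADivisor.ofIdeal I) = ∑ v ∈ T, (multiplicity v.asIdeal I : ℝ) * logNorm F v := by
    rw [degF_apply, ADivisor.ofIdeal, dif_neg hI, Finsupp.sum_sumElim, Finsupp.sum_zero_index, zero_add]
    rw [Finsupp.sum_of_support_subset _ (s := T) ?_ _ (fun v _ => by simp)]
    · refine Finset.sum_congr rfl fun v _ => ?_
      simp [Finsupp.ofSupportFinite_coe]
    · intro v hv
      rw [Finsupp.mem_support_iff, Finsupp.ofSupportFinite_coe] at hv
      rw [hT, Set.Finite.mem_toFinset]
      exact fun h => hv (by simp [h])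
  rw [hdeg, hnorm, Real.log_prod (fun v _ => pow_ne_zero _ (by
      exact_mod_cast (Ideal.absNorm_eq_zero_iff.not.mpr v.ne_bot)))]
  refine Finset.sum_congr rfl fun v _ => ?_
  rw [Real.log_pow, logNorm]

/-- Normalised form: `deg(Σ_v ord_v(I)·v) = log N(I) / [F:ℚ]`. [cite: MochizukiGenEll2010, Def. 1.5 (iii) p.9] -/
theorem ndeg_ofIdeal {I : Ideal (𝓞 F)} (hI : I ≠ ⊥) :
    ndeg F (ADivisor.ofIdeal I) = Real.log (Ideal.absNorm I) / Module.finrank ℚ F := by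
  rw [ndeg_apply, degF_ofIdeal F hI]

/-! ### (iii) the different divisor `δ` and `log-diff` -/

/-- **`δ_x`**: the different ideal `𝔡_F` of `F` (over `ℤ`) as an effective arithmetic divisor on `F`.
[cite: MochizukiGenEll2010, Def. 1.5 (iii) p.9] -/
def differentDivisor : ADivisor F := ADivisor.ofIdeal (differentIdeal ℤ (𝓞 F))

/-- The different ideal is nonzero. [cite: MochizukiGenEll2010, Def. 1.5 (iii) p.9] -/
theorem differentIdeal_ne_bot' : differentIdeal ℤ (𝓞 F) ≠ ⊥ := by
  intro h
  have h2 := NumberField.absNorm_differentIdeal F (𝓞 F)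
  rw [h, Ideal.absNorm_bot] at h2
  exact (Int.natAbs_ne_zero.mpr (NumberField.discr_ne_zero F)) h2.symm

/-- `δ` is effective. [cite: MochizukiGenEll2010, Def. 1.5 (iii) p.9] -/
theorem differentDivisor_isEffective : (differentDivisor F).IsEffective :=
  ADivisor.ofIdeal_isEffective _

/-- `deg_F(δ) = log N(𝔡_F) = log |disc F|`. [cite: MochizukiGenEll2010, Def. 1.5 (iii) p.9] -/
theorem degF_differentDivisor :
    degF F (differentDivisor F) = Real.log ((NumberField.discr F).natAbs) := by
  rw [differentDivisor, degF_ofIdeal F (differentIdeal_ne_bot' F), NumberField.absNorm_differentIdeal F (𝓞 F)]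

/-- **`log-diff_X(x) = deg(δ_x)`**: the tree's `NFPoint.logDiff` IS the normalised degree of the
different divisor of the (minimal) field of the point. [cite: MochizukiGenEll2010, Def. 1.5 (iii) p.9] -/
theorem logDiff_eq_ndeg_differentDivisor (P : NFPoint) :
    P.logDiff = ndeg P.F (differentDivisor P.F) := by
  rw [NFPoint.logDiff, ndeg_apply, differentDivisor, degF_ofIdeal P.F (differentIdeal_ne_bot' P.F),
    NFPoint.degree, div_eq_inv_mul]

/-! ### (iv) reduced divisors and `log-cond` -/

namespace ADivisor

variable {F}

/-- **The reduced effective divisor** `Σ_{v ∈ S} v` on a finite set `S` of finite places (e.g.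
`(D_x)_red`). [cite: MochizukiGenEll2010, Def. 1.5 (iv) p.9] -/
def reduced (S : Finset (HeightOneSpectrum (𝓞 F))) : ADivisor F :=
  ∑ v ∈ S, ADivisor.of (Sum.inr v) 1

omit [NumberField F] in
open scoped Classical in
/-- Coefficients of a reduced divisor: `1` on `S`, `0` elsewhere. [cite: MochizukiGenEll2010, Def. 1.5 (iv) p.9] -/
theorem reduced_apply_inr (S : Finset (HeightOneSpectrum (𝓞 F))) (v : HeightOneSpectrum (𝓞 F)) :
    reduced S (Sum.inr v) = if v ∈ S then 1 else 0 := by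
  rw [reduced, Finsupp.finsetSum_apply]
  simp only [Finsupp.single_apply, Sum.inr.injEq]
  rw [Finset.sum_ite_eq' S v]

/-- `deg_F(Σ_{v∈S} v) = Σ_{v∈S} log(q_v)`. [cite: MochizukiGenEll2010, Def. 1.5 (iv) p.9] -/
theorem degF_reduced_eq_sum (S : Finset (HeightOneSpectrum (𝓞 F))) :
    degF F (reduced S) = ∑ v ∈ S, logNorm F v := by
  rw [reduced, map_sum]
  refine Finset.sum_congr rfl fun v _ => ?_
  rw [degF_of_inr, one_mul]

/-- `deg_F(Σ_{v∈S} v) = Σ_{v∈S} log(q_v) = log ∏_{v ∈ S} N(v)`. [cite: MochizukiGenEll2010, Def. 1.5 (iv) p.9] -/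
theorem degF_reduced (S : Finset (HeightOneSpectrum (𝓞 F))) :
    degF F (reduced S) = Real.log ((∏ v ∈ S, Ideal.absNorm v.asIdeal : ℕ) : ℝ) := by
  rw [degF_reduced_eq_sum, Nat.cast_prod,
    Real.log_prod (fun v _ => by exact_mod_cast (Ideal.absNorm_eq_zero_iff.not.mpr v.ne_bot))]
  rfl

omit [NumberField F] in
/-- A reduced divisor is effective. [cite: MochizukiGenEll2010, Def. 1.5 (iv) p.9] -/
theorem reduced_isEffective (S : Finset (HeightOneSpectrum (𝓞 F))) : (reduced S).IsEffective := by
  classical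
  intro v
  rw [reduced, Finsupp.finsetSum_apply]
  exact Finset.sum_nonneg fun w _ => by
    rw [Finsupp.single_apply]; split_ifs <;> norm_num

end ADivisor

/-- **`(D_x)_red`** for `x ∈ U_P(F)`: the reduced conductor divisor, supported on `supp D_x = condSupport`
(finite for `x ≠ 0, 1`). [cite: MochizukiGenEll2010, Def. 1.5 (iv) p.9] -/
def condDivisor (P : NFPoint) (hP : P.InU) : ADivisor P.F :=
  ADivisor.reduced (NFPoint.condSupport_finite P hP).toFinset

/-- **`log-cond_D(x) = deg((D_x)_red)`**: the tree's `NFPoint.logCond` IS the normalised degree of the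
reduced conductor divisor (for `x ∈ U_P(F)`). [cite: MochizukiGenEll2010, Def. 1.5 (iv) p.9] -/
theorem logCond_eq_ndeg_condDivisor (P : NFPoint) (hP : P.InU) :
    P.logCond = ndeg P.F (condDivisor P hP) := by
  rw [NFPoint.logCond, ndeg_apply, condDivisor, ADivisor.degF_reduced, NFPoint.degree, div_eq_inv_mul,
    finprod_mem_eq_finite_toFinset_prod _ (NFPoint.condSupport_finite P hP)]

end Literature.IUT.LogVolume

end
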